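import Mathlib
import Summits.Ventures.PercRepro2.MixChordOInactiveD
import Summits.Ventures.PercRepro2.PendantRoot

/-!
# The three `a₃`-free chords along the `o`-edge `{o, a₁}`: `I`, `J`, `J′` (blind cell PercRepro2,
night-1 g22; proofs/NIGHT1-G22.md §1)

For the cleared covariances `C(X, Y) = P(Q)·P(Q ∩ X ∩ Y) − P(Q ∩ X)·P(Q ∩ Y)` of `PendantRoot.lean`
(`covC`), three `a₃`-FREE functionals of the `(b, o)` side table under `Q = {a₁ ↮ a₂}`:
`I = −2C(oH, bL) − 2C(oL, bH)` (the `a₃`-inactive value of `Gc/Z`, two cross-cluster BHK slacks),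
`J = 2C(oL, bL) − 2C(oL, bH)` and `J′ = 2C(oH, bH) − 2C(oH, bL)` (the `a₃ := a₂`, resp. `a₃ := a₁`,
endpoints of typer-1's pendant-at-root identity).  Along the `o`-edge `f = {o, a₁}` at weight `q`
each satisfies the chord `(1 − q)·X(p[f ↦ 0]) ≤ X(p)` (the open child `p[f ↦ 1]` has `o ∈ C₁`
surely and `X = 0` there), by an exact identity in the pinned masses and BHK at the closed child:

* **`iChord`**: g20's inactive `D`-chord row (`i_key` = g20's `o_key_D` without the `Z⁰` factor):
  `(I(q) − (1 − q)·I⁰)/2 = q(1 − q)·(H⁰·W + HB⁰·(Z⁰ − O⁰) − H⁰·(B⁰ − BO⁰))` — `W ≥ 0` and the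
  same-cluster BHK `bhk_oH_bH_avoid`;
* **`jChord`**: the NEW row (`j_key`)
  `(J(q) − (1 − q)·J⁰)/2 = q(1 − q)·[W·(Z⁰ − O⁰) + N⁰·(HB⁰ − LH⁰) + H⁰·(NL⁰ − NH⁰)]`,
  `N⁰ = P⁰(Q, o ∉ U)`, `NL⁰ = P⁰(Q, o ∉ U, bL)`, `NH⁰ = P⁰(Q, o ∉ U, bH)`: `W ≥ 0`, the same
  BHK as `I` (`N⁰·HB⁰ ≥ H⁰·NH⁰`) and the CROSS BHK with the root `a₁` avoiding `{a₂, o}`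
  (**`bhk_oH_bL_avoid`**: `H⁰·NL⁰ ≥ N⁰·LH⁰`, BHK06 Thm 1.4 `bhk_cross_cluster_avoid`);
* **`j'Chord`**: the trivial row (`j'_key`) `(J′(q) − (1 − q)·J′⁰)/2 = q(1 − q)·H⁰·W`.
Here `Z⁰ = P⁰(Q)`, `O⁰ = P⁰(Q, oL)`, `H⁰ = P⁰(Q, oH)`, `L⁰ = P⁰(Q, bL)`, `B⁰ = P⁰(Q, bH)`,
`LH⁰ = P⁰(Q, oH, bL)`, `HB⁰ = P⁰(Q, oH, bH)`, `BO⁰ = P⁰(Q, oL, bH)`, `LL⁰ = P⁰(Q, oL, bL)` (closed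
child), `L¹ = P¹(Q, bL) = L⁰ − LH⁰ + W`, `W = P⁰(Q, o ∉ U, o ↔ b) ≥ 0`, `Z¹ = Z⁰ − H⁰`, `B¹ = B⁰ − HB⁰`
(g18's couplings).  Used by MixChordOLeafRoot.lean.  Census (own exact code, data/night-1/g22/, 450
random instances n ≤ 7): `J`-chord 0 / 450, `J′`-chord 0 / 450, the row identities exact 450 / 450.  Own code; standard axioms.
-/

namespace Summit.Ventures.PercRepro2

open UnionCluster CovForm

namespace Mix

section Keys

variable {R : Type*} [CommRing R]

/-- The `I`-chord identity along `{o, a₁}` (g20's `o_key_D` without the `Z⁰` factor): with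
`Z¹ = Z⁰ − H⁰`, `B¹ = B⁰ − HB⁰`, `L¹ = L⁰ − LH⁰ + W`, `H¹ = LH¹ = 0`, `O¹ = Z¹`, `BO¹ = B¹`,
`S(q) − (1 − q)·S⁰ = q(1 − q)·(H⁰·W + HB⁰·(Z⁰ − O⁰) − H⁰·(B⁰ − BO⁰))`. -/
lemma i_key (q Z0 Z1 L0 L1 B0 B1 H0 LH0 O0 BO0 HB0 W : R) (hZ1 : Z1 = Z0 - H0)
    (hB1 : B1 = B0 - HB0) (hL1 : L1 = L0 - LH0 + W) :
    (((q * L1 + (1 - q) * L0) * (q * 0 + (1 - q) * H0) -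
          (q * Z1 + (1 - q) * Z0) * (q * 0 + (1 - q) * LH0)) +
        ((q * B1 + (1 - q) * B0) * (q * Z1 + (1 - q) * O0) -
          (q * Z1 + (1 - q) * Z0) * (q * B1 + (1 - q) * BO0))) -
      (1 - q) * ((L0 * H0 - Z0 * LH0) + (B0 * O0 - Z0 * BO0)) =
      q * (1 - q) * (H0 * W + HB0 * (Z0 - O0) - H0 * (B0 - BO0)) := by
  subst hZ1 hB1 hL1
  ring

/-- The `J`-chord identity along `{o, a₁}`: with the same couplings and `LL¹ = L¹`, `O¹ = Z¹`,
`(J(q) − (1 − q)·J⁰)/2 = q(1 − q)·(W·(Z⁰ − O⁰) + (Z⁰ − O⁰ − H⁰)·(HB⁰ − LH⁰) + H⁰·((L⁰ − LL⁰ − LH⁰) − (B⁰ − BO⁰ − HB⁰)))`. -/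
lemma j_key (q Z0 Z1 L0 L1 B0 B1 H0 LH0 O0 BO0 HB0 LL0 W : R) (hZ1 : Z1 = Z0 - H0)
    (hB1 : B1 = B0 - HB0) (hL1 : L1 = L0 - LH0 + W) :
    (((q * Z1 + (1 - q) * Z0) * (q * L1 + (1 - q) * LL0) -
          (q * Z1 + (1 - q) * O0) * (q * L1 + (1 - q) * L0)) -
        ((q * Z1 + (1 - q) * Z0) * (q * B1 + (1 - q) * BO0) -
          (q * Z1 + (1 - q) * O0) * (q * B1 + (1 - q) * B0))) -
      (1 - q) * ((Z0 * LL0 - O0 * L0) - (Z0 * BO0 - O0 * B0)) =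
      q * (1 - q) * (W * (Z0 - O0) + (Z0 - O0 - H0) * (HB0 - LH0) +
        H0 * ((L0 - LL0 - LH0) - (B0 - BO0 - HB0))) := by
  subst hZ1 hB1 hL1
  ring

/-- The `J′`-chord identity along `{o, a₁}` (`H¹ = HB¹ = LH¹ = 0`):
`(J′(q) − (1 − q)·J′⁰)/2 = q(1 − q)·H⁰·W`. -/
lemma j'_key (q Z0 Z1 L0 L1 B0 B1 H0 LH0 HB0 W : R) (hZ1 : Z1 = Z0 - H0)
    (hB1 : B1 = B0 - HB0) (hL1 : L1 = L0 - LH0 + W) :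
    (((q * Z1 + (1 - q) * Z0) * (q * 0 + (1 - q) * HB0) -
          (q * 0 + (1 - q) * H0) * (q * B1 + (1 - q) * B0)) -
        ((q * Z1 + (1 - q) * Z0) * (q * 0 + (1 - q) * LH0) -
          (q * 0 + (1 - q) * H0) * (q * L1 + (1 - q) * L0))) -
      (1 - q) * ((Z0 * HB0 - H0 * B0) - (Z0 * LH0 - H0 * L0)) =
      q * (1 - q) * (H0 * W) := by
  subst hZ1 hB1 hL1
  ring

end Keys

section Chords

variable {V : Type*} {E : Type*} [Fintype E] [DecidableEq E] [Fintype V] [DecidableEq V]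
  {R : Type*} [Field R] [LinearOrder R] [IsStrictOrderedRing R]

variable (p : E → R) (ends : E → Sym2 V) {o a₁ a₂ : V} (b : V) {f : E}

omit [Fintype E] [DecidableEq E] [Fintype V] [LinearOrder R] [IsStrictOrderedRing R] in
/-- `{a₁ ↔ b} ∩ {a₂ ↔ o} ∩ {a₁ ↮ a₂, a₁ ↮ o} = Q ∩ ({a₂ ↔ o} ∩ {a₁ ↔ b})`. -/
lemma conn1b_conn2o_inter_avoid (o a₁ a₂ b : V) :
    connEvent ends a₁ b ∩ connEvent ends a₂ o ∩ avoidAll ends a₁ {a₂, o} =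
      avoidAll ends a₂ {a₁} ∩ (connEvent ends a₂ o ∩ connEvent ends a₁ b) := by
  ext ω
  simp only [Set.mem_inter_iff, mem_connEvent, mem_avoidAll, Finset.mem_insert,
    Finset.mem_singleton, forall_eq_or_imp, forall_eq]
  constructor
  · rintro ⟨⟨h1b, h2o⟩, h12, _⟩
    exact ⟨fun h => h12 (conn_symm h), h2o, h1b⟩
  · rintro ⟨h21, h2o, h1b⟩
    exact ⟨⟨h1b, h2o⟩, fun h => h21 (conn_symm h), fun h => h21 (conn_trans h2o (conn_symm h))⟩

omit [Fintype E] [DecidableEq E] [Fintype V] [LinearOrder R] [IsStrictOrderedRing R] in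
/-- `{a₁ ↔ b} ∩ {a₁ ↮ a₂, a₁ ↮ o} = (Q ∩ {a₁ ↔ b}) ∩ {a₁ ↔ o}ᶜ`. -/
lemma conn1b_inter_avoid (o a₁ a₂ b : V) :
    connEvent ends a₁ b ∩ avoidAll ends a₁ {a₂, o} =
      (avoidAll ends a₂ {a₁} ∩ connEvent ends a₁ b) ∩ (connEvent ends a₁ o)ᶜ := by
  ext ω
  simp only [Set.mem_inter_iff, mem_connEvent, mem_avoidAll, Finset.mem_insert,
    Finset.mem_singleton, forall_eq_or_imp, forall_eq, Set.mem_compl_iff]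
  constructor
  · rintro ⟨h1b, h12, h1o⟩
    exact ⟨⟨fun h => h12 (conn_symm h), h1b⟩, h1o⟩
  · rintro ⟨⟨h21, h1b⟩, h1o⟩
    exact ⟨h1b, fun h => h21 (conn_symm h), h1o⟩

omit [Fintype E] [DecidableEq E] [Fintype V] [DecidableEq V] [LinearOrder R] [IsStrictOrderedRing R] in
/-- `Q ∩ {a₁ ↔ b} ∩ {a₁ ↔ o} = Q ∩ ({a₁ ↔ o} ∩ {a₁ ↔ b})`. -/
lemma Q_conn1b_conn1o (o a₁ a₂ b : V) :
    avoidAll ends a₂ {a₁} ∩ connEvent ends a₁ b ∩ connEvent ends a₁ o =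
      avoidAll ends a₂ {a₁} ∩ (connEvent ends a₁ o ∩ connEvent ends a₁ b) := by
  ext ω
  simp only [Set.mem_inter_iff]
  tauto

/-- **Cross-cluster BHK for `{b ∈ C₁}`, `{o ∈ C₂}` with the root `a₁` avoiding `{a₂, o}`**
(BHK06 Thm 1.4, `bhk_cross_cluster_avoid`): conditionally on `a₁ ↮ a₂, a₁ ↮ o` the two events are
negatively correlated — `P(Q, oH, bL)·(P(Q) − P(Q, oL)) ≤ P(Q, oH)·(P(Q, bL) − P(Q, oL, bL))`. -/
lemma bhk_oH_bL_avoid (hp : IsProbVec p) (o a₁ a₂ : V) :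
    prob p (avoidAll ends a₂ {a₁} ∩ (connEvent ends a₂ o ∩ connEvent ends a₁ b)) *
        (prob p (avoidAll ends a₂ {a₁}) - prob p (avoidAll ends a₂ {a₁} ∩ connEvent ends a₁ o)) ≤
      prob p (avoidAll ends a₂ {a₁} ∩ connEvent ends a₂ o) *
        (prob p (avoidAll ends a₂ {a₁} ∩ connEvent ends a₁ b) -
          prob p (avoidAll ends a₂ {a₁} ∩ (connEvent ends a₁ o ∩ connEvent ends a₁ b))) := by
  have h := bhk_cross_cluster_avoid p hp ends a₁ a₂ (X := ({a₂, o} : Finset V))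
    (Finset.mem_insert_self a₂ {o}) (𝓤 := {W : Set V | b ∈ W}) (𝓥 := {W : Set V | o ∈ W})
    (fun _ _ hle h => hle h) (fun _ _ hle h => hle h)
  rw [PendantRoot.clusterInEvent_mem, PendantRoot.clusterInEvent_mem, conn1b_conn2o_inter_avoid,
    conn1b_inter_avoid, conn2o_inter_avoid, avoid_pair_eq] at h
  have e1 := prob_inter_add_prob_inter_compl p (avoidAll ends a₂ {a₁} ∩ connEvent ends a₁ b)
    (connEvent ends a₁ o)
  have e2 := prob_inter_add_prob_inter_compl p (avoidAll ends a₂ {a₁}) (connEvent ends a₁ o)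
  rw [Q_conn1b_conn1o] at e1
  have e1' : prob p (avoidAll ends a₂ {a₁} ∩ connEvent ends a₁ b ∩ (connEvent ends a₁ o)ᶜ) =
      prob p (avoidAll ends a₂ {a₁} ∩ connEvent ends a₁ b) -
        prob p (avoidAll ends a₂ {a₁} ∩ (connEvent ends a₁ o ∩ connEvent ends a₁ b)) := by
    linarith
  have e2' : prob p (avoidAll ends a₂ {a₁} ∩ (connEvent ends a₁ o)ᶜ) =
      prob p (avoidAll ends a₂ {a₁}) - prob p (avoidAll ends a₂ {a₁} ∩ connEvent ends a₁ o) := by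
    linarith
  rw [e1', e2'] at h
  linarith [h]

/-- **The `I`-chord along `f = {o, a₁}`**: `(1 − q)·I(p[f ↦ 0]) ≤ I(p)` for the `a₃`-free functional
`I = −2C(oH, bL) − 2C(oL, bH)` (g20's inactive `D`-chord, as a statement about the masses). -/
lemma iChord (hp : IsProbVec p) (hf : ends f = s(o, a₁)) :
    (1 - p f) *
        (-2 * PendantRoot.covC (Function.update p f 0) ends a₁ a₂ (connEvent ends a₂ o)
            (connEvent ends a₁ b) -
          2 * PendantRoot.covC (Function.update p f 0) ends a₁ a₂ (connEvent ends a₁ o)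
            (connEvent ends a₂ b)) ≤
      -2 * PendantRoot.covC p ends a₁ a₂ (connEvent ends a₂ o) (connEvent ends a₁ b) -
        2 * PendantRoot.covC p ends a₁ a₂ (connEvent ends a₁ o) (connEvent ends a₂ b) := by
  have hp0 : IsProbVec (Function.update p f 0) := hp.update f le_rfl zero_le_one
  have hq0 := hp.nonneg f
  have hq1 := hp.le_one f
  have hc1 := conn_a1_o_of_update_one p ends hf
  have hH0 := prob_nonneg hp0 (avoidAll ends a₂ {a₁} ∩ connEvent ends a₂ o)
  have hZ1 := RootEdge.prob_Q_update_one p ends (a₂ := a₂) hf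
  rw [TEvent_o] at hZ1
  have hB1 := RootEdge.prob_Q_conn2_update_one p ends (a₂ := a₂) hf b
  rw [TEvent_o_inter] at hB1
  have hL1 := RootEdge.prob_Q_conn1_update_one_ge p ends (a₂ := a₂) hp hf b
  rw [TEvent_o_inter] at hL1
  have hH1 : prob (Function.update p f 1) (avoidAll ends a₂ {a₁} ∩ connEvent ends a₂ o) = 0 :=
    prob_Q_conn₂_eq_zero _ ends hc1
  have hLH1 : prob (Function.update p f 1)
      (avoidAll ends a₂ {a₁} ∩ (connEvent ends a₂ o ∩ connEvent ends a₁ b)) = 0 :=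
    prob_inter_conn₂_eq_zero _ ends hc1 _ _ le_rfl
  have hO1 : prob (Function.update p f 1) (avoidAll ends a₂ {a₁} ∩ connEvent ends a₁ o) =
      prob (Function.update p f 1) (avoidAll ends a₂ {a₁}) :=
    prob_inter_conn_eq' _ ends hc1 _
  have hBO1 : prob (Function.update p f 1)
      (avoidAll ends a₂ {a₁} ∩ (connEvent ends a₁ o ∩ connEvent ends a₂ b)) =
      prob (Function.update p f 1) (avoidAll ends a₂ {a₁} ∩ connEvent ends a₂ b) :=
    prob_inter_conn_eq _ ends hc1 _ _
  have hbhk := bhk_oH_bH_avoid (Function.update p f 0) ends b hp0 o a₁ a₂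
  have pQ := prob_eq_pin p (avoidAll ends a₂ {a₁}) f
  have pL := prob_eq_pin p (avoidAll ends a₂ {a₁} ∩ connEvent ends a₁ b) f
  have pH := prob_eq_pin p (avoidAll ends a₂ {a₁} ∩ connEvent ends a₂ o) f
  have pLH := prob_eq_pin p (avoidAll ends a₂ {a₁} ∩ (connEvent ends a₂ o ∩ connEvent ends a₁ b)) f
  have pB := prob_eq_pin p (avoidAll ends a₂ {a₁} ∩ connEvent ends a₂ b) f
  have pO := prob_eq_pin p (avoidAll ends a₂ {a₁} ∩ connEvent ends a₁ o) f
  have pBO := prob_eq_pin p (avoidAll ends a₂ {a₁} ∩ (connEvent ends a₁ o ∩ connEvent ends a₂ b)) f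
  rw [hH1, hLH1, hO1, hBO1] at *
  have hW : 0 ≤ prob (Function.update p f 1) (avoidAll ends a₂ {a₁} ∩ connEvent ends a₁ b) -
      (prob (Function.update p f 0) (avoidAll ends a₂ {a₁} ∩ connEvent ends a₁ b) -
        prob (Function.update p f 0)
          (avoidAll ends a₂ {a₁} ∩ (connEvent ends a₂ o ∩ connEvent ends a₁ b))) := by
    linarith
  have hid := i_key (p f) (prob (Function.update p f 0) (avoidAll ends a₂ {a₁}))
    (prob (Function.update p f 1) (avoidAll ends a₂ {a₁}))
    (prob (Function.update p f 0) (avoidAll ends a₂ {a₁} ∩ connEvent ends a₁ b))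
    (prob (Function.update p f 1) (avoidAll ends a₂ {a₁} ∩ connEvent ends a₁ b))
    (prob (Function.update p f 0) (avoidAll ends a₂ {a₁} ∩ connEvent ends a₂ b))
    (prob (Function.update p f 1) (avoidAll ends a₂ {a₁} ∩ connEvent ends a₂ b))
    (prob (Function.update p f 0) (avoidAll ends a₂ {a₁} ∩ connEvent ends a₂ o))
    (prob (Function.update p f 0) (avoidAll ends a₂ {a₁} ∩ (connEvent ends a₂ o ∩ connEvent ends a₁ b)))
    (prob (Function.update p f 0) (avoidAll ends a₂ {a₁} ∩ connEvent ends a₁ o))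
    (prob (Function.update p f 0) (avoidAll ends a₂ {a₁} ∩ (connEvent ends a₁ o ∩ connEvent ends a₂ b)))
    (prob (Function.update p f 0) (avoidAll ends a₂ {a₁} ∩ (connEvent ends a₂ o ∩ connEvent ends a₂ b)))
    (prob (Function.update p f 1) (avoidAll ends a₂ {a₁} ∩ connEvent ends a₁ b) -
      (prob (Function.update p f 0) (avoidAll ends a₂ {a₁} ∩ connEvent ends a₁ b) -
        prob (Function.update p f 0)
          (avoidAll ends a₂ {a₁} ∩ (connEvent ends a₂ o ∩ connEvent ends a₁ b))))
    hZ1 hB1 (by ring)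
  have hbr : 0 ≤ prob (Function.update p f 0) (avoidAll ends a₂ {a₁} ∩ connEvent ends a₂ o) *
      (prob (Function.update p f 1) (avoidAll ends a₂ {a₁} ∩ connEvent ends a₁ b) -
        (prob (Function.update p f 0) (avoidAll ends a₂ {a₁} ∩ connEvent ends a₁ b) -
          prob (Function.update p f 0)
            (avoidAll ends a₂ {a₁} ∩ (connEvent ends a₂ o ∩ connEvent ends a₁ b)))) +
      prob (Function.update p f 0) (avoidAll ends a₂ {a₁} ∩ (connEvent ends a₂ o ∩ connEvent ends a₂ b)) *
        (prob (Function.update p f 0) (avoidAll ends a₂ {a₁}) -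
          prob (Function.update p f 0) (avoidAll ends a₂ {a₁} ∩ connEvent ends a₁ o)) -
      prob (Function.update p f 0) (avoidAll ends a₂ {a₁} ∩ connEvent ends a₂ o) *
        (prob (Function.update p f 0) (avoidAll ends a₂ {a₁} ∩ connEvent ends a₂ b) -
          prob (Function.update p f 0)
            (avoidAll ends a₂ {a₁} ∩ (connEvent ends a₁ o ∩ connEvent ends a₂ b))) := by
    linarith [mul_nonneg hH0 hW, hbhk]
  have key := mul_nonneg (mul_nonneg hq0 (sub_nonneg.2 hq1)) hbr
  rw [← hid] at key
  unfold PendantRoot.covC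
  rw [pQ, pL, pH, pLH, pB, pO, pBO]
  linear_combination 2 * key

/-- **The `J`-chord along `f = {o, a₁}`**: `(1 − q)·J(p[f ↦ 0]) ≤ J(p)` for the `a₃`-free functional
`J = 2C(oL, bL) − 2C(oL, bH)` — the new row `j_key`: `W ≥ 0`, the same-cluster BHK
`bhk_oH_bH_avoid` and the cross BHK `bhk_oH_bL_avoid`, all at `p[f ↦ 0]`. -/
lemma jChord (hp : IsProbVec p) (hf : ends f = s(o, a₁)) :
    (1 - p f) *
        (2 * PendantRoot.covC (Function.update p f 0) ends a₁ a₂ (connEvent ends a₁ o)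
            (connEvent ends a₁ b) -
          2 * PendantRoot.covC (Function.update p f 0) ends a₁ a₂ (connEvent ends a₁ o)
            (connEvent ends a₂ b)) ≤
      2 * PendantRoot.covC p ends a₁ a₂ (connEvent ends a₁ o) (connEvent ends a₁ b) -
        2 * PendantRoot.covC p ends a₁ a₂ (connEvent ends a₁ o) (connEvent ends a₂ b) := by
  have hp0 : IsProbVec (Function.update p f 0) := hp.update f le_rfl zero_le_one
  have hq0 := hp.nonneg f
  have hq1 := hp.le_one f
  have hc1 := conn_a1_o_of_update_one p ends hf
  have hZO : 0 ≤ prob (Function.update p f 0) (avoidAll ends a₂ {a₁}) -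
      prob (Function.update p f 0) (avoidAll ends a₂ {a₁} ∩ connEvent ends a₁ o) :=
    sub_nonneg.2 (prob_inter_le_left hp0 _ _)
  have hZ1 := RootEdge.prob_Q_update_one p ends (a₂ := a₂) hf
  rw [TEvent_o] at hZ1
  have hB1 := RootEdge.prob_Q_conn2_update_one p ends (a₂ := a₂) hf b
  rw [TEvent_o_inter] at hB1
  have hL1 := RootEdge.prob_Q_conn1_update_one_ge p ends (a₂ := a₂) hp hf b
  rw [TEvent_o_inter] at hL1
  have hLL1 : prob (Function.update p f 1)
      (avoidAll ends a₂ {a₁} ∩ (connEvent ends a₁ o ∩ connEvent ends a₁ b)) =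
      prob (Function.update p f 1) (avoidAll ends a₂ {a₁} ∩ connEvent ends a₁ b) :=
    prob_inter_conn_eq _ ends hc1 _ _
  have hO1 : prob (Function.update p f 1) (avoidAll ends a₂ {a₁} ∩ connEvent ends a₁ o) =
      prob (Function.update p f 1) (avoidAll ends a₂ {a₁}) :=
    prob_inter_conn_eq' _ ends hc1 _
  have hBO1 : prob (Function.update p f 1)
      (avoidAll ends a₂ {a₁} ∩ (connEvent ends a₁ o ∩ connEvent ends a₂ b)) =
      prob (Function.update p f 1) (avoidAll ends a₂ {a₁} ∩ connEvent ends a₂ b) :=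
    prob_inter_conn_eq _ ends hc1 _ _
  have hbhk₁ := bhk_oH_bH_avoid (Function.update p f 0) ends b hp0 o a₁ a₂
  have hbhk₂ := bhk_oH_bL_avoid (Function.update p f 0) ends b hp0 o a₁ a₂
  have pQ := prob_eq_pin p (avoidAll ends a₂ {a₁}) f
  have pLL := prob_eq_pin p (avoidAll ends a₂ {a₁} ∩ (connEvent ends a₁ o ∩ connEvent ends a₁ b)) f
  have pO := prob_eq_pin p (avoidAll ends a₂ {a₁} ∩ connEvent ends a₁ o) f
  have pL := prob_eq_pin p (avoidAll ends a₂ {a₁} ∩ connEvent ends a₁ b) f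
  have pBO := prob_eq_pin p (avoidAll ends a₂ {a₁} ∩ (connEvent ends a₁ o ∩ connEvent ends a₂ b)) f
  have pB := prob_eq_pin p (avoidAll ends a₂ {a₁} ∩ connEvent ends a₂ b) f
  rw [hLL1, hO1, hBO1] at *
  have hW : 0 ≤ prob (Function.update p f 1) (avoidAll ends a₂ {a₁} ∩ connEvent ends a₁ b) -
      (prob (Function.update p f 0) (avoidAll ends a₂ {a₁} ∩ connEvent ends a₁ b) -
        prob (Function.update p f 0)
          (avoidAll ends a₂ {a₁} ∩ (connEvent ends a₂ o ∩ connEvent ends a₁ b))) := by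
    linarith
  have hid := j_key (p f) (prob (Function.update p f 0) (avoidAll ends a₂ {a₁}))
    (prob (Function.update p f 1) (avoidAll ends a₂ {a₁}))
    (prob (Function.update p f 0) (avoidAll ends a₂ {a₁} ∩ connEvent ends a₁ b))
    (prob (Function.update p f 1) (avoidAll ends a₂ {a₁} ∩ connEvent ends a₁ b))
    (prob (Function.update p f 0) (avoidAll ends a₂ {a₁} ∩ connEvent ends a₂ b))
    (prob (Function.update p f 1) (avoidAll ends a₂ {a₁} ∩ connEvent ends a₂ b))
    (prob (Function.update p f 0) (avoidAll ends a₂ {a₁} ∩ connEvent ends a₂ o))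
    (prob (Function.update p f 0) (avoidAll ends a₂ {a₁} ∩ (connEvent ends a₂ o ∩ connEvent ends a₁ b)))
    (prob (Function.update p f 0) (avoidAll ends a₂ {a₁} ∩ connEvent ends a₁ o))
    (prob (Function.update p f 0) (avoidAll ends a₂ {a₁} ∩ (connEvent ends a₁ o ∩ connEvent ends a₂ b)))
    (prob (Function.update p f 0) (avoidAll ends a₂ {a₁} ∩ (connEvent ends a₂ o ∩ connEvent ends a₂ b)))
    (prob (Function.update p f 0) (avoidAll ends a₂ {a₁} ∩ (connEvent ends a₁ o ∩ connEvent ends a₁ b)))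
    (prob (Function.update p f 1) (avoidAll ends a₂ {a₁} ∩ connEvent ends a₁ b) -
      (prob (Function.update p f 0) (avoidAll ends a₂ {a₁} ∩ connEvent ends a₁ b) -
        prob (Function.update p f 0)
          (avoidAll ends a₂ {a₁} ∩ (connEvent ends a₂ o ∩ connEvent ends a₁ b))))
    hZ1 hB1 (by ring)
  have hbr : 0 ≤ (prob (Function.update p f 1) (avoidAll ends a₂ {a₁} ∩ connEvent ends a₁ b) -
      (prob (Function.update p f 0) (avoidAll ends a₂ {a₁} ∩ connEvent ends a₁ b) -
        prob (Function.update p f 0)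
          (avoidAll ends a₂ {a₁} ∩ (connEvent ends a₂ o ∩ connEvent ends a₁ b)))) *
      (prob (Function.update p f 0) (avoidAll ends a₂ {a₁}) -
        prob (Function.update p f 0) (avoidAll ends a₂ {a₁} ∩ connEvent ends a₁ o)) +
      (prob (Function.update p f 0) (avoidAll ends a₂ {a₁}) -
        prob (Function.update p f 0) (avoidAll ends a₂ {a₁} ∩ connEvent ends a₁ o) -
        prob (Function.update p f 0) (avoidAll ends a₂ {a₁} ∩ connEvent ends a₂ o)) *
      (prob (Function.update p f 0) (avoidAll ends a₂ {a₁} ∩ (connEvent ends a₂ o ∩ connEvent ends a₂ b)) -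
        prob (Function.update p f 0) (avoidAll ends a₂ {a₁} ∩ (connEvent ends a₂ o ∩ connEvent ends a₁ b))) +
      prob (Function.update p f 0) (avoidAll ends a₂ {a₁} ∩ connEvent ends a₂ o) *
      ((prob (Function.update p f 0) (avoidAll ends a₂ {a₁} ∩ connEvent ends a₁ b) -
          prob (Function.update p f 0) (avoidAll ends a₂ {a₁} ∩ (connEvent ends a₁ o ∩ connEvent ends a₁ b)) -
          prob (Function.update p f 0) (avoidAll ends a₂ {a₁} ∩ (connEvent ends a₂ o ∩ connEvent ends a₁ b))) -
        (prob (Function.update p f 0) (avoidAll ends a₂ {a₁} ∩ connEvent ends a₂ b) -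
          prob (Function.update p f 0) (avoidAll ends a₂ {a₁} ∩ (connEvent ends a₁ o ∩ connEvent ends a₂ b)) -
          prob (Function.update p f 0) (avoidAll ends a₂ {a₁} ∩ (connEvent ends a₂ o ∩ connEvent ends a₂ b)))) := by
    nlinarith [mul_nonneg hW hZO, hbhk₁, hbhk₂]
  have key := mul_nonneg (mul_nonneg hq0 (sub_nonneg.2 hq1)) hbr
  rw [← hid] at key
  unfold PendantRoot.covC
  rw [pQ, pLL, pO, pL, pBO, pB]
  linear_combination 2 * key

omit [Fintype V] [DecidableEq V] in
/-- **The `J′`-chord along `f = {o, a₁}`**: `(1 − q)·J′(p[f ↦ 0]) ≤ J′(p)` for the `a₃`-free functional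
`J′ = 2C(oH, bH) − 2C(oH, bL)` — the row is `H⁰·W ≥ 0` (`j'_key`). -/
lemma j'Chord (hp : IsProbVec p) (hf : ends f = s(o, a₁)) :
    (1 - p f) *
        (2 * PendantRoot.covC (Function.update p f 0) ends a₁ a₂ (connEvent ends a₂ o)
            (connEvent ends a₂ b) -
          2 * PendantRoot.covC (Function.update p f 0) ends a₁ a₂ (connEvent ends a₂ o)
            (connEvent ends a₁ b)) ≤
      2 * PendantRoot.covC p ends a₁ a₂ (connEvent ends a₂ o) (connEvent ends a₂ b) -
        2 * PendantRoot.covC p ends a₁ a₂ (connEvent ends a₂ o) (connEvent ends a₁ b) := by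
  have hp0 : IsProbVec (Function.update p f 0) := hp.update f le_rfl zero_le_one
  have hq0 := hp.nonneg f
  have hq1 := hp.le_one f
  have hc1 := conn_a1_o_of_update_one p ends hf
  have hH0 := prob_nonneg hp0 (avoidAll ends a₂ {a₁} ∩ connEvent ends a₂ o)
  have hZ1 := RootEdge.prob_Q_update_one p ends (a₂ := a₂) hf
  rw [TEvent_o] at hZ1
  have hB1 := RootEdge.prob_Q_conn2_update_one p ends (a₂ := a₂) hf b
  rw [TEvent_o_inter] at hB1
  have hL1 := RootEdge.prob_Q_conn1_update_one_ge p ends (a₂ := a₂) hp hf b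
  rw [TEvent_o_inter] at hL1
  have hH1 : prob (Function.update p f 1) (avoidAll ends a₂ {a₁} ∩ connEvent ends a₂ o) = 0 :=
    prob_Q_conn₂_eq_zero _ ends hc1
  have hLH1 : prob (Function.update p f 1)
      (avoidAll ends a₂ {a₁} ∩ (connEvent ends a₂ o ∩ connEvent ends a₁ b)) = 0 :=
    prob_inter_conn₂_eq_zero _ ends hc1 _ _ le_rfl
  have hHB1 : prob (Function.update p f 1)
      (avoidAll ends a₂ {a₁} ∩ (connEvent ends a₂ o ∩ connEvent ends a₂ b)) = 0 :=
    prob_inter_conn₂_eq_zero _ ends hc1 _ _ le_rfl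
  have pQ := prob_eq_pin p (avoidAll ends a₂ {a₁}) f
  have pHB := prob_eq_pin p (avoidAll ends a₂ {a₁} ∩ (connEvent ends a₂ o ∩ connEvent ends a₂ b)) f
  have pH := prob_eq_pin p (avoidAll ends a₂ {a₁} ∩ connEvent ends a₂ o) f
  have pB := prob_eq_pin p (avoidAll ends a₂ {a₁} ∩ connEvent ends a₂ b) f
  have pLH := prob_eq_pin p (avoidAll ends a₂ {a₁} ∩ (connEvent ends a₂ o ∩ connEvent ends a₁ b)) f
  have pL := prob_eq_pin p (avoidAll ends a₂ {a₁} ∩ connEvent ends a₁ b) f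
  rw [hH1, hLH1, hHB1] at *
  have hW : 0 ≤ prob (Function.update p f 1) (avoidAll ends a₂ {a₁} ∩ connEvent ends a₁ b) -
      (prob (Function.update p f 0) (avoidAll ends a₂ {a₁} ∩ connEvent ends a₁ b) -
        prob (Function.update p f 0)
          (avoidAll ends a₂ {a₁} ∩ (connEvent ends a₂ o ∩ connEvent ends a₁ b))) := by
    linarith
  have hid := j'_key (p f) (prob (Function.update p f 0) (avoidAll ends a₂ {a₁}))
    (prob (Function.update p f 1) (avoidAll ends a₂ {a₁}))
    (prob (Function.update p f 0) (avoidAll ends a₂ {a₁} ∩ connEvent ends a₁ b))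
    (prob (Function.update p f 1) (avoidAll ends a₂ {a₁} ∩ connEvent ends a₁ b))
    (prob (Function.update p f 0) (avoidAll ends a₂ {a₁} ∩ connEvent ends a₂ b))
    (prob (Function.update p f 1) (avoidAll ends a₂ {a₁} ∩ connEvent ends a₂ b))
    (prob (Function.update p f 0) (avoidAll ends a₂ {a₁} ∩ connEvent ends a₂ o))
    (prob (Function.update p f 0) (avoidAll ends a₂ {a₁} ∩ (connEvent ends a₂ o ∩ connEvent ends a₁ b)))
    (prob (Function.update p f 0) (avoidAll ends a₂ {a₁} ∩ (connEvent ends a₂ o ∩ connEvent ends a₂ b)))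
    (prob (Function.update p f 1) (avoidAll ends a₂ {a₁} ∩ connEvent ends a₁ b) -
      (prob (Function.update p f 0) (avoidAll ends a₂ {a₁} ∩ connEvent ends a₁ b) -
        prob (Function.update p f 0)
          (avoidAll ends a₂ {a₁} ∩ (connEvent ends a₂ o ∩ connEvent ends a₁ b))))
    hZ1 hB1 (by ring)
  have key := mul_nonneg (mul_nonneg hq0 (sub_nonneg.2 hq1)) (mul_nonneg hH0 hW)
  rw [← hid] at key
  unfold PendantRoot.covC
  rw [pQ, pHB, pH, pB, pLH, pL]
  linear_combination 2 * key

end Chords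


end Mix

end Summit.Ventures.PercRepro2
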